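import Summits.RiemannHypothesis.RiemannHypothesis.Theorems.PfPersistenceF6NestedWindows
import HarnessLib

/-!
# PF-persistence THEORY 3 (gen 5) — the NEGATIVE INDEX of a nested Galerkin family is MONOTONE
# UP the `N`-ladder (publication cell `pub-rhpf`, theory seat 3)

Framing (page 1 of every `pub-rhpf` file): **mechanism/rigidity campaign — nothing here is a claim
about RH.** Everything in this file is PROVED elementary linear algebra; no statement about `ζ` or about
any control family is made; every empirical sentence in the docstrings is labelled DATA and refers to
`THEORY-INTRUDER.md` §10 of the cell.

WHY (THEORY-INTRUDER.md §10.5 / §10.9 / §10.10; CLOSED-CLASSES row TH3-N3). The multi-driver law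
(`PfPersistenceIntruderShadowMulti`) counts the negative directions of a window `(a, N)` of a CONTROL by the
eigenvalues above `1` of one `m × m` capacitance matrix, and its DATA rows beyond the served ladder are
FIXED-`N` engine builds (DH: `N = 530`, `a = 1.85 … 2.00`; Epstein `x² + 5y²`: `N = 360`, `a = 1.70 … 1.80`).
This file records the bookkeeping fact that turns every such row into a LOWER BOUND at every finer
truncation: for a windowed family whose `(a, N')` block is the leading principal submatrix of its `(a, N)` block
(`N' ≤ N` — true for every observatory object, whose entries `W_X(θ_{ξ_n, ξ_m})` do not depend on the truncation
rank; in the tree for weight tables as `F6.evenBlock_castLE`), a `k`-dimensional subspace on which the `(a, N')`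
form is negative definite zero-extends to one for `(a, N)`. Hence `n₋(a, N') ≥ k ⇒ n₋(a, N) ≥ k` for all
`N ≥ N'`: a second negative direction, once present at `(1.90, 530)` (DATA), is present at `(1.90, N)` for every
`N ≥ 530`, and the activation half-length of a driver can only move to SMALLER `a` as `N` grows. The case `k = 1`
is the tree's `F6.windowNegative_mono`; the UPPER bound `n₋ ≤ #drivers` (TH3-N3 (a),
`OffLineSplitN.negSubspace_finrank_le`) needs the driver-completed block `B_m ⪰ 0` and propagates only DOWN in `N`.

"Negative index at least `k`" is written INLINE, in the shape of `OffLineSplitN.negSubspace_iff_capacitance`: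
`∃ W : Submodule ℝ (Fin n → ℝ), Module.finrank ℝ W = k ∧ ∀ v ∈ W, v ≠ 0 → v ⬝ᵥ (M *ᵥ v) < 0`.

KERNEL content (all PROVED):
* `negSubspace_one_iff`             — `k = 1` ↔ `∃ v, v ⬝ᵥ (M *ᵥ v) < 0`; `negSubspace_of_le` — downward closed in `k`;
* `dotProduct_extend_mulVec_extend` — the form is preserved by zero-extension along an injection;
* `negSubspace_of_submatrix`        — a `k`-dimensional negative subspace of `M.submatrix f f` (`f` injective) gives one
                                      of `M` (Cauchy interlacing / inclusion principle in counting form; [folklore],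
                                      Horn–Johnson, *Matrix Analysis* 2nd ed., Thm 4.3.28);
* `datumOf_nested`                  — the nesting property, PROVED for every weight table (`= F6.evenBlock_castLE`);
* `negSubspace_mono_of_nested`      — nested datum, `N' ≤ N` ⇒ index `≥ k` passes from `(a, N')` to `(a, N)`;
* `negSubspace_evenBlock_mono`      — the weight-table instance; `windowNegative_mono_of_nested` — `k = 1` for nested data.
-/

set_option linter.dupNamespace false  -- the mandated namespace repeats `RiemannHypothesis`

noncomputable section

open Matrix Finset

namespace Summit.RiemannHypothesis.RiemannHypothesis.Theorems.PfPersistenceIntruderIndexMono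

open Summit.RiemannHypothesis.RiemannHypothesis.Theorems.PfPersistence
open Summit.RiemannHypothesis.RiemannHypothesis.Theorems.PfPersistence.F6

variable {m n : ℕ}

/-- PROVED: negative index `≥ 1` iff some vector has negative form value (the shape used by `F6.windowNegative_mono`
and by `PfPersistence.DetectablyNegative`). [folklore] -/
theorem negSubspace_one_iff (M : Matrix (Fin n) (Fin n) ℝ) :
    (∃ W : Submodule ℝ (Fin n → ℝ), Module.finrank ℝ W = 1 ∧ ∀ v ∈ W, v ≠ 0 → v ⬝ᵥ (M *ᵥ v) < 0) ↔
      ∃ v : Fin n → ℝ, v ⬝ᵥ (M *ᵥ v) < 0 := by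
  constructor
  · rintro ⟨W, hW1, hW⟩
    have hne : W ≠ ⊥ := by
      rintro rfl
      simp at hW1
    obtain ⟨w, hwW, hw0⟩ := Submodule.exists_mem_ne_zero_of_ne_bot hne
    exact ⟨w, hW w hwW hw0⟩
  · rintro ⟨v, hv⟩
    have hv0 : v ≠ 0 := by
      rintro rfl
      simp at hv
    refine ⟨Submodule.span ℝ {v}, finrank_span_singleton hv0, ?_⟩
    intro x hx hx0
    obtain ⟨c, rfl⟩ := Submodule.mem_span_singleton.1 hx
    have hc : c ≠ 0 := by
      rintro rfl
      exact hx0 (zero_smul ℝ v)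
    have hform : (c • v) ⬝ᵥ (M *ᵥ (c • v)) = c ^ 2 * (v ⬝ᵥ (M *ᵥ v)) := by
      rw [mulVec_smul, smul_dotProduct, dotProduct_smul, smul_eq_mul, smul_eq_mul]
      ring
    rw [hform]
    exact mul_neg_of_pos_of_neg (by positivity) hv

/-- PROVED: "negative index `≥ k`" is downward closed in `k`. [folklore] -/
theorem negSubspace_of_le {M : Matrix (Fin n) (Fin n) ℝ} {k k' : ℕ}
    (hk : ∃ W : Submodule ℝ (Fin n → ℝ), Module.finrank ℝ W = k ∧ ∀ v ∈ W, v ≠ 0 → v ⬝ᵥ (M *ᵥ v) < 0)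
    (hle : k' ≤ k) :
    ∃ W : Submodule ℝ (Fin n → ℝ), Module.finrank ℝ W = k' ∧ ∀ v ∈ W, v ≠ 0 → v ⬝ᵥ (M *ᵥ v) < 0 := by
  obtain ⟨W, hWk, hW⟩ := hk
  let b := Module.finBasisOfFinrankEq ℝ W hWk
  have hli : LinearIndependent ℝ (fun i : Fin k' => (b (Fin.castLE hle i) : Fin n → ℝ)) := by
    have h1 : LinearIndependent ℝ (fun i : Fin k => (b i : Fin n → ℝ)) :=
      b.linearIndependent.map' W.subtype (Submodule.ker_subtype W)
    exact h1.comp (Fin.castLE hle) (Fin.castLE_injective hle)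
  refine ⟨Submodule.span ℝ (Set.range fun i : Fin k' => (b (Fin.castLE hle i) : Fin n → ℝ)), ?_, ?_⟩
  · rw [finrank_span_eq_card hli, Fintype.card_fin]
  · intro v hv hv0
    have hvW : v ∈ W := by
      refine (Submodule.span_le.2 ?_) hv
      rintro _ ⟨i, rfl⟩
      exact (b _).2
    exact hW v hvW hv0

/-- PROVED (bookkeeping): the form value of the zero-extension of `u` along an injection `f` is the form value of `u`
for the principal compression `M.submatrix f f` (the identity inside `F6.rayleigh_floor_submatrix`, exported). -/
theorem dotProduct_extend_mulVec_extend (M : Matrix (Fin n) (Fin n) ℝ) (f : Fin m → Fin n)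
    (hf : Function.Injective f) (u : Fin m → ℝ) :
    Function.extend f u 0 ⬝ᵥ (M *ᵥ Function.extend f u 0) = u ⬝ᵥ (M.submatrix f f *ᵥ u) := by
  classical
  set v : Fin n → ℝ := Function.extend f u 0 with hv
  have inner : ∀ j, (∑ l, M j l * v l) = ∑ k, M j (f k) * u k := by
    intro j
    have h2 := sum_extend_mul f hf u (fun l => M j l)
    calc (∑ l, M j l * v l) = ∑ l, v l * M j l := by
            refine Finset.sum_congr rfl ?_; intro l _; ring
      _ = ∑ k, u k * M j (f k) := h2
      _ = ∑ k, M j (f k) * u k := by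
            refine Finset.sum_congr rfl ?_; intro k _; ring
  simp only [dotProduct, mulVec, Matrix.submatrix_apply]
  have h3 := sum_extend_mul f hf u (fun j => ∑ l, M j l * v l)
  calc (∑ j, v j * ∑ l, M j l * v l) = ∑ i, u i * ∑ l, M (f i) l * v l := h3
    _ = ∑ i, u i * ∑ k, M (f i) (f k) * u k := by
          refine Finset.sum_congr rfl ?_; intro i _; rw [inner (f i)]

/-- PROVED (Cauchy interlacing / inclusion principle, counting form): a `k`-dimensional subspace on which the principal
compression `M.submatrix f f` (`f` injective) is negative definite zero-extends to one for `M` — the negative index can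
only GROW from a principal submatrix to the matrix. [cite: HornJohnson2013, Thm 4.3.28] -/
theorem negSubspace_of_submatrix (M : Matrix (Fin n) (Fin n) ℝ) (f : Fin m → Fin n)
    (hf : Function.Injective f) {k : ℕ}
    (h : ∃ W : Submodule ℝ (Fin m → ℝ), Module.finrank ℝ W = k ∧
      ∀ u ∈ W, u ≠ 0 → u ⬝ᵥ (M.submatrix f f *ᵥ u) < 0) :
    ∃ W : Submodule ℝ (Fin n → ℝ), Module.finrank ℝ W = k ∧ ∀ v ∈ W, v ≠ 0 → v ⬝ᵥ (M *ᵥ v) < 0 := by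
  classical
  obtain ⟨W, hWk, hW⟩ := h
  let E : (Fin m → ℝ) →ₗ[ℝ] (Fin n → ℝ) := Function.ExtendByZero.linearMap ℝ f
  have hE_apply : ∀ u, E u = Function.extend f u 0 := fun u => rfl
  have hE : Function.Injective E := by
    intro u w huw
    funext i
    have h1 : E u (f i) = u i := by rw [hE_apply]; exact hf.extend_apply _ _ _
    have h2 : E w (f i) = w i := by rw [hE_apply]; exact hf.extend_apply _ _ _
    rw [← h1, ← h2, huw]
  refine ⟨W.map E, ?_, ?_⟩
  · rw [← hWk]
    exact (Submodule.equivMapOfInjective E hE W).finrank_eq.symm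
  · intro v hv hv0
    obtain ⟨u, huW, rfl⟩ := Submodule.mem_map.1 hv
    have hu0 : u ≠ 0 := by
      rintro rfl
      exact hv0 (map_zero E)
    rw [hE_apply, dotProduct_extend_mulVec_extend M f hf u]
    exact hW u huW hu0

/-- PROVED: every weight-table datum is NESTED in `N` — at fixed half-length `a` the `(a, N')` block is the leading principal
submatrix of the `(a, N)` block for `N' ≤ N` (restates `F6.evenBlock_castLE` for `datumOf`; holds for every observatory
object, whose entries are rank-independent). -/
theorem datumOf_nested (w : Weights) :
    ∀ (a : ℝ) (ha : 0 < a) (N' N : ℕ) (h : N' ≤ N), datumOf w ⟨a, N', ha⟩ =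
      (datumOf w ⟨a, N, ha⟩).submatrix (Fin.castLE (Nat.succ_le_succ h)) (Fin.castLE (Nat.succ_le_succ h)) :=
  fun _a ha _N' _N h => evenBlock_castLE w ha h

/-- PROVED: for a NESTED windowed family the negative index is MONOTONE UP the `N`-ladder at fixed `a`
(`k`-version of `F6.windowNegative_mono`): `n₋(a, N') ≥ k ⇒ n₋(a, N) ≥ k` whenever `N' ≤ N`. -/
theorem negSubspace_mono_of_nested (D : Datum)
    (hD : ∀ (a : ℝ) (ha : 0 < a) (N' N : ℕ) (h : N' ≤ N), D ⟨a, N', ha⟩ =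
      (D ⟨a, N, ha⟩).submatrix (Fin.castLE (Nat.succ_le_succ h)) (Fin.castLE (Nat.succ_le_succ h)))
    {a : ℝ} (ha : 0 < a) {N' N : ℕ} (h : N' ≤ N) {k : ℕ}
    (hk : ∃ W : Submodule ℝ (Fin (N' + 1) → ℝ), Module.finrank ℝ W = k ∧
      ∀ u ∈ W, u ≠ 0 → u ⬝ᵥ (D ⟨a, N', ha⟩ *ᵥ u) < 0) :
    ∃ W : Submodule ℝ (Fin (N + 1) → ℝ), Module.finrank ℝ W = k ∧
      ∀ v ∈ W, v ≠ 0 → v ⬝ᵥ (D ⟨a, N, ha⟩ *ᵥ v) < 0 := by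
  rw [hD a ha N' N h] at hk
  exact negSubspace_of_submatrix _ _ (Fin.castLE_injective _) hk

/-- PROVED: the weight-table instance — for EVERY weight table, a `k`-dimensional negative subspace of the `(a, N')` even
block zero-extends to one of the `(a, N)` block, `N' ≤ N`. -/
theorem negSubspace_evenBlock_mono (w : Weights) {a : ℝ} (ha : 0 < a) {N' N : ℕ} (h : N' ≤ N) {k : ℕ}
    (hk : ∃ W : Submodule ℝ (Fin (N' + 1) → ℝ), Module.finrank ℝ W = k ∧
      ∀ u ∈ W, u ≠ 0 → u ⬝ᵥ (evenBlock w ⟨a, N', ha⟩ *ᵥ u) < 0) :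
    ∃ W : Submodule ℝ (Fin (N + 1) → ℝ), Module.finrank ℝ W = k ∧
      ∀ v ∈ W, v ≠ 0 → v ⬝ᵥ (evenBlock w ⟨a, N, ha⟩ *ᵥ v) < 0 :=
  negSubspace_mono_of_nested (datumOf w) (datumOf_nested w) ha h hk

/-- PROVED (sanity link to the tree): `k = 1` for any nested datum is the statement of `F6.windowNegative_mono`. -/
theorem windowNegative_mono_of_nested (D : Datum)
    (hD : ∀ (a : ℝ) (ha : 0 < a) (N' N : ℕ) (h : N' ≤ N), D ⟨a, N', ha⟩ =
      (D ⟨a, N, ha⟩).submatrix (Fin.castLE (Nat.succ_le_succ h)) (Fin.castLE (Nat.succ_le_succ h)))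
    {a : ℝ} (ha : 0 < a) {N' N : ℕ} (h : N' ≤ N)
    (hneg : ∃ u : Fin (N' + 1) → ℝ, u ⬝ᵥ (D ⟨a, N', ha⟩ *ᵥ u) < 0) :
    ∃ v : Fin (N + 1) → ℝ, v ⬝ᵥ (D ⟨a, N, ha⟩ *ᵥ v) < 0 :=
  (negSubspace_one_iff _).1 (negSubspace_mono_of_nested D hD ha h ((negSubspace_one_iff _).2 hneg))

end Summit.RiemannHypothesis.RiemannHypothesis.Theorems.PfPersistenceIntruderIndexMono

end
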